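/-
Copyright (c) 2026 the pub-hodgecm-mathlib formalisation cell (harness21).  Prover seat hodgecm-mathlib-K2E5-p17 (g5), Track B «K2-LIT» ∕ h413
(`stmt-HodgeConjecture-24833`), line `K2_E3_EllipticInputs`, road (11-3-split-nsc) `sig_K2E3CharLocIntNearSemisimpleSplitThreeNonSupercuspidal` (U12 ED. 20 :419),
brick (nsc-K𝔟-MU): THE BOREL `M U`-COORDINATES — the Haar measure `νT ⊗ μN` of `T × N₃` pushed to the Borel slice `b(r) ⊂ 𝔤𝔩₃(F)`.  2026-09-04.
-/
import Summits.HodgeConjecture.HodgeConjecture.Theorems.K2E3GL3BorelUnipotentHaar   -- ★ (K2E3-p11 (g4)): `exists_coordHomeomorph`, `exists_haar_eq_smul_map_coord`, `map_coordScale` on `N₃`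
import Literature.NumberTheory.Automorphic.LocalFieldHaarBalls                    -- ★ `LocalFieldHaar.isHaarMeasure_unitsMeasure`, `measure_singleton_zero`, `measurableEmbedding_unitsVal`
import Literature.NumberTheory.Automorphic.GLnUnipotentRadicalUnimodular           -- ★ `mem_standardLeviGL_id_iff` (the diagonal torus `M_id`)
import Mathlib.MeasureTheory.Measure.Haar.Unique
import HarnessLib

/-!
# K2_E3 road (h413), (11-3-split-nsc) brick (nsc-K𝔟-MU) — the Borel Levi–unipotent coordinates of `GL₃(F)`

Cell `pub/hodgecm-mathlib` (D-0151), Track B, seat K2E5-p17 (g5); road owner K2E3-p11 (g6) (BRICK LIST v1∕v1.1, `K2/STATUS.md` 2026-09-04 07:52Z∕07:55Z),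
dealer K2E3-plan (g3) (DEAL 08:08Z), cut MU ∕ D with K2E3-p17 (g7) (08:09Z): this file is the `hMU` input of `Theorems/K2E3GL3BorelKMUDomination.lean`.
`--supports stmt-HodgeConjecture-24833 --as helper`; THEOREMS ONLY (no definition ∕ instance ∕ notation ∕ named fact ∕ `sorry`); never imports `Cruxes/…/Lines`.
THE MATHEMATICS.  `F` a non-archimedean local field, `dx` an additive Haar measure on `F`, `‖·‖ = normAbs F`; `T = standardLeviGL F id` the diagonal torus of
`GL₃(F)`, `N₃ = unipotentRadicalGL F id` the upper unitriangular group, Haar measures `νT`, `μN`.  §1 `T ≅ (Fˣ × Fˣ) × Fˣ` as topological groups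
(`exists_continuousMulEquiv_units_torus`), so by Haar uniqueness and `d^×x = ‖x‖⁻¹ dx` (★ `LocalFieldHaar.isHaarMeasure_unitsMeasure`)
`∫_T φ dνT = c·∫_{F³} φ(diag d) ‖d₀d₁d₂‖⁻¹ dd` (`exists_lintegral_torus_eq_mul_lintegral_prod`); §2 the re-indexing `(((d₀,d₁),d₂),((x,y),z)) ↦ (d₀,x,z,d₁,y,d₂)`
carries `dx^{⊗3} ⊗ dx^{⊗3}` to `dx^{⊗6}`; §3 `t·u = diag(d)·[[1,x,z],[0,1,y],[0,0,1]] = b(d₀, d₀x, d₀z, d₁, d₁y, d₂)` and `x' = d₀x, z' = d₀z, y' = d₁y` costs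
`‖d₀‖⁻²‖d₁‖⁻¹` (★ `map_coordScale`): **`∫_T∫_{N₃} g(t u) dμN dνT = c·∫_{F⁶} 1[r₀r₃r₅ ≠ 0] g(b(r)) (‖r₀‖³‖r₃‖²‖r₅‖)⁻¹ dr`**, `b(r) = [[r₀,r₁,r₂],[0,r₃,r₄],[0,0,r₅]]`
(`exists_lintegral_torus_unipotent_eq_mul_lintegral_pi`) — the left Haar measure of the Borel subgroup `B = T N₃` in the additive coordinates of `𝔟 ≅ F⁶` with
its modulus density [Cartier1979, §IV.1 p. 145]; [WeilBNT1967, Ch. II §1]; [BernsteinZelevinsky1976, §1.19]; [Tate1950, §2.2].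
HONEST LABEL: HC_CM is proved only modulo the 7 printed citations (2 remaining named inputs: hLiu418 = stmt-HodgeConjecture-24832, h413 =
stmt-HodgeConjecture-24833) until rung 0 closes; count-neutral helper.

## References
* [Cartier1979] P. Cartier, *Representations of p-adic groups: a survey*, Proc. Sympos. Pure Math. 33 (1979), Part 1, §IV.1 p. 145.
* [WeilBNT1967] A. Weil, *Basic Number Theory*, Grundlehren 144 (1967), Ch. I §4, Ch. II §1.
* [BernsteinZelevinsky1976] I. N. Bernstein, A. V. Zelevinsky, *Representations of the group GL(n,F)*, Russian Math. Surveys 31 (1976), §1.18–§1.19.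
* [Tate1950] J. Tate, *Fourier analysis in number fields and Hecke's zeta-functions* (1950), §2.2 (`d^×x = |x|⁻¹ dx`).
-/

set_option autoImplicit false
set_option linter.dupNamespace false   -- `Summit.HodgeConjecture.HodgeConjecture.…` (D-0017 nested layout; lakefile exemption for Summits)

noncomputable section

open MeasureTheory Measure Filter Topology TopologicalSpace
open scoped MatrixGroups NNReal ENNReal
open Literature.NumberTheory.Automorphic
open Literature.NumberTheory.GaloisRepresentations Literature.NumberTheory.GaloisRepresentations.IsNonarchimedeanLocalField

namespace Summit.HodgeConjecture.HodgeConjecture.Cruxes.H413.K2E3GL3BorelLeviUnipotentCoordinates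

/-! ## §1  The diagonal torus `T = standardLeviGL F id` in coordinates -/

section TorusAlgebra

variable {F : Type*} [Field F] [TopologicalSpace F]

/-- **The diagonal torus of `GL₃(F)` is `(Fˣ × Fˣ) × Fˣ` as a topological group**: there is a continuous multiplicative equivalence
`e : (Fˣ × Fˣ) × Fˣ ≃ₜ* T` with `↑(e((a,b),c)) = diag(a,b,c)`. [cite: Cartier1979, §IV.1] [cite: BernsteinZelevinsky1977, §2.1] -/
theorem exists_continuousMulEquiv_units_torus :
    ∃ e : (Fˣ × Fˣ) × Fˣ ≃ₜ* ↥(standardLeviGL F (id : Fin 3 → Fin 3)),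
      ∀ w : (Fˣ × Fˣ) × Fˣ,
        (((e w : ↥(standardLeviGL F (id : Fin 3 → Fin 3))) : GL (Fin 3) F) : Matrix (Fin 3) (Fin 3) F) =
          Matrix.diagonal ![(w.1.1 : F), (w.1.2 : F), (w.2 : F)] := by
  -- the diagonal matrix of `w` is multiplicative in `w`
  have hmul : ∀ w w' : (Fˣ × Fˣ) × Fˣ,
      Matrix.diagonal ![(w.1.1 : F), (w.1.2 : F), (w.2 : F)] * Matrix.diagonal ![(w'.1.1 : F), (w'.1.2 : F), (w'.2 : F)] =
        Matrix.diagonal ![((w * w').1.1 : F), ((w * w').1.2 : F), ((w * w').2 : F)] := fun w w' => by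
    rw [Matrix.diagonal_mul_diagonal]; congr 1; funext i; fin_cases i <;> simp
  have hone : Matrix.diagonal ![((1 : (Fˣ × Fˣ) × Fˣ).1.1 : F), ((1 : (Fˣ × Fˣ) × Fˣ).1.2 : F), ((1 : (Fˣ × Fˣ) × Fˣ).2 : F)] =
      (1 : Matrix (Fin 3) (Fin 3) F) := by
    ext i j; by_cases hij : i = j
    · subst hij; fin_cases i <;> simp
    · rw [Matrix.diagonal_apply_ne _ hij, Matrix.one_apply_ne hij]
  -- the hom `(Fˣ × Fˣ) × Fˣ →* GL₃(F)`, valued in `T`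
  let φ : (Fˣ × Fˣ) × Fˣ →* GL (Fin 3) F :=
    { toFun := fun w => ⟨Matrix.diagonal ![(w.1.1 : F), (w.1.2 : F), (w.2 : F)],
        Matrix.diagonal ![((w⁻¹).1.1 : F), ((w⁻¹).1.2 : F), ((w⁻¹).2 : F)],
        by rw [hmul, mul_inv_cancel, hone], by rw [hmul, inv_mul_cancel, hone]⟩
      map_one' := Units.ext hone
      map_mul' := fun w w' => Units.ext (hmul w w').symm }
  have hφ : ∀ w, ((φ w : GL (Fin 3) F) : Matrix (Fin 3) (Fin 3) F) = Matrix.diagonal ![(w.1.1 : F), (w.1.2 : F), (w.2 : F)] := fun w => rfl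
  have hmem : ∀ w, φ w ∈ standardLeviGL F (id : Fin 3 → Fin 3) := fun w =>
    (mem_standardLeviGL_id_iff _).2 fun i j hij => by rw [hφ, Matrix.diagonal_apply_ne _ hij]
  -- the diagonal entries of `t ∈ T` are units `u_i(t) = (t_ii, (t⁻¹)_ii)`
  have hoff : ∀ (t : ↥(standardLeviGL F (id : Fin 3 → Fin 3))) (i j : Fin 3), i ≠ j →
      ((t : GL (Fin 3) F) : Matrix (Fin 3) (Fin 3) F) i j = 0 := fun t => (mem_standardLeviGL_id_iff _).1 t.2
  have hvalinv : ∀ (t : ↥(standardLeviGL F (id : Fin 3 → Fin 3))) (i : Fin 3),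
      ((t : GL (Fin 3) F) : Matrix (Fin 3) (Fin 3) F) i i * (((t : GL (Fin 3) F)⁻¹ : GL (Fin 3) F) : Matrix (Fin 3) (Fin 3) F) i i = 1 := by
    intro t i
    have h := congrArg (fun M : Matrix (Fin 3) (Fin 3) F => M i i) (Units.mul_inv (t : GL (Fin 3) F))
    simp only [Matrix.mul_apply, Matrix.one_apply_eq] at h
    rwa [Finset.sum_eq_single i (fun j _ hji => by rw [hoff t i j (Ne.symm hji), zero_mul])
      (fun hi => absurd (Finset.mem_univ i) hi)] at h
  let U : ↥(standardLeviGL F (id : Fin 3 → Fin 3)) → Fin 3 → Fˣ := fun t i =>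
    ⟨((t : GL (Fin 3) F) : Matrix (Fin 3) (Fin 3) F) i i, (((t : GL (Fin 3) F)⁻¹ : GL (Fin 3) F) : Matrix (Fin 3) (Fin 3) F) i i,
      hvalinv t i, by rw [mul_comm]; exact hvalinv t i⟩
  have hUc : ∀ i, Continuous fun t => U t i := fun i => by
    refine Units.continuous_iff.2 ⟨?_, ?_⟩
    · show Continuous fun t : ↥(standardLeviGL F (id : Fin 3 → Fin 3)) => ((t : GL (Fin 3) F) : Matrix (Fin 3) (Fin 3) F) i i
      exact (Units.continuous_val.comp continuous_subtype_val).matrix_elem i i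
    · show Continuous fun t : ↥(standardLeviGL F (id : Fin 3 → Fin 3)) => (((t : GL (Fin 3) F)⁻¹ : GL (Fin 3) F) : Matrix (Fin 3) (Fin 3) F) i i
      exact (Units.continuous_coe_inv.comp continuous_subtype_val).matrix_elem i i
  -- the equivalence
  let e₀ : (Fˣ × Fˣ) × Fˣ ≃* ↥(standardLeviGL F (id : Fin 3 → Fin 3)) :=
    { toFun := fun w => ⟨φ w, hmem w⟩
      invFun := fun t => ((U t 0, U t 1), U t 2)
      left_inv := fun w => by
        refine Prod.ext (Prod.ext (Units.ext ?_) (Units.ext ?_)) (Units.ext ?_)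
        · show Matrix.diagonal ![(w.1.1 : F), (w.1.2 : F), (w.2 : F)] 0 0 = (w.1.1 : F); simp
        · show Matrix.diagonal ![(w.1.1 : F), (w.1.2 : F), (w.2 : F)] 1 1 = (w.1.2 : F); simp
        · show Matrix.diagonal ![(w.1.1 : F), (w.1.2 : F), (w.2 : F)] 2 2 = (w.2 : F); simp
      right_inv := fun t => by
        refine Subtype.ext (Units.ext (Matrix.ext fun i j => ?_))
        by_cases hij : i = j
        · subst hij; rw [hφ, Matrix.diagonal_apply_eq]; fin_cases i <;> rfl
        · rw [hφ, Matrix.diagonal_apply_ne _ hij, hoff t i j hij]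
      map_mul' := fun w w' => Subtype.ext (φ.map_mul w w') }
  have hc1 : Continuous fun w : (Fˣ × Fˣ) × Fˣ => (w.1.1 : F) := Units.continuous_val.comp continuous_fst.fst
  have hc2 : Continuous fun w : (Fˣ × Fˣ) × Fˣ => (w.1.2 : F) := Units.continuous_val.comp continuous_fst.snd
  have hc3 : Continuous fun w : (Fˣ × Fˣ) × Fˣ => (w.2 : F) := Units.continuous_val.comp continuous_snd
  have hi1 : Continuous fun w : (Fˣ × Fˣ) × Fˣ => (((w⁻¹).1.1 : Fˣ) : F) := Units.continuous_coe_inv.comp continuous_fst.fst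
  have hi2 : Continuous fun w : (Fˣ × Fˣ) × Fˣ => (((w⁻¹).1.2 : Fˣ) : F) := Units.continuous_coe_inv.comp continuous_fst.snd
  have hi3 : Continuous fun w : (Fˣ × Fˣ) × Fˣ => (((w⁻¹).2 : Fˣ) : F) := Units.continuous_coe_inv.comp continuous_snd
  have hval : Continuous fun w : (Fˣ × Fˣ) × Fˣ => (φ w : GL (Fin 3) F) := by
    refine Units.continuous_iff.2 ⟨?_, ?_⟩
    · exact (hc1.matrixVecCons (hc2.matrixVecCons (hc3.matrixVecCons continuous_const))).matrix_diagonal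
    · exact (hi1.matrixVecCons (hi2.matrixVecCons (hi3.matrixVecCons continuous_const))).matrix_diagonal
  exact ⟨{ e₀ with
      continuous_toFun := hval.subtype_mk hmem
      continuous_invFun := ((hUc 0).prodMk (hUc 1)).prodMk (hUc 2) }, fun w => rfl⟩

omit [TopologicalSpace F] in
/-- **`diag(d) · n(x,y,z) = b(d₀, d₀x, d₀z, d₁, d₁y, d₂)`**: a diagonal matrix times an upper unitriangular one, in the slice coordinates.
[cite: Cartier1979, §IV.1] -/
theorem diagonal_mul_unipotent (p q : (F × F) × F) :
    Matrix.diagonal ![p.1.1, p.1.2, p.2] * !![(1 : F), q.1.1, q.2; 0, 1, q.1.2; 0, 0, 1] =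
      !![p.1.1, p.1.1 * q.1.1, p.1.1 * q.2; 0, p.1.2, p.1.2 * q.1.2; 0, 0, p.2] := by
  ext i j; fin_cases i <;> fin_cases j <;> simp [Matrix.mul_apply, Fin.sum_univ_three]

/-- `p ↦ diag(p₀, p₁, p₂)` is continuous on `(F × F) × F`. [folklore] -/
theorem continuous_diagonal_prod :
    Continuous fun p : (F × F) × F => (Matrix.diagonal ![p.1.1, p.1.2, p.2] : Matrix (Fin 3) (Fin 3) F) :=
  (continuous_fst.fst.matrixVecCons (continuous_fst.snd.matrixVecCons (continuous_snd.matrixVecCons continuous_const))).matrix_diagonal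

/-- The Borel slice `r ↦ b(r) = [[r₀,r₁,r₂],[0,r₃,r₄],[0,0,r₅]]` is measurable. [folklore] -/
theorem measurable_borelSlice [SecondCountableTopology F] [MeasurableSpace F] [BorelSpace F]
    [MeasurableSpace (Matrix (Fin 3) (Fin 3) F)] [BorelSpace (Matrix (Fin 3) (Fin 3) F)] :
    Measurable fun r : Fin 6 → F => (!![r 0, r 1, r 2; 0, r 3, r 4; 0, 0, r 5] : Matrix (Fin 3) (Fin 3) F) := by
  refine (continuous_matrix (fun i j => ?_)).measurable; fin_cases i <;> fin_cases j <;> simp <;> fun_prop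

end TorusAlgebra

section TorusHaar

variable {F : Type*} [Field F] [ValuativeRel F] [TopologicalSpace F] [IsNonarchimedeanLocalField F]
  [MeasurableSpace F] [BorelSpace F]
  [MeasurableSpace (Matrix (Fin 3) (Fin 3) F)] [BorelSpace (Matrix (Fin 3) (Fin 3) F)]
  [MeasurableSpace ↥(standardLeviGL F (id : Fin 3 → Fin 3))] [BorelSpace ↥(standardLeviGL F (id : Fin 3 → Fin 3))]

/-- **THE HAAR MEASURE OF THE DIAGONAL TORUS IN ADDITIVE COORDINATES**: for a Haar measure `νT` on `T = M_id ≤ GL₃(F)` and an additive Haar measure `dx`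
on `F` there is `c ∈ (0, ∞)` with `∫_T φ(t) dνT = c · ∫_{F³} φ(diag(d₀,d₁,d₂)) · ‖d₀ d₁ d₂‖⁻¹ d(dx⊗dx⊗dx)` for every Borel `φ ≥ 0` on `𝔤𝔩₃(F)`
(`T ≅ (Fˣ)³`, `d^×x = ‖x‖⁻¹ dx` is a Haar measure on `Fˣ`, Haar uniqueness on the second countable locally compact group `T`; `‖0‖⁻¹ = 0`, so no indicator
is needed). [cite: WeilBNT1967, Ch. II §1] [cite: Tate1950, §2.2] [cite: Cartier1979, §IV.1] -/
theorem exists_lintegral_torus_eq_mul_lintegral_prod (νT : Measure ↥(standardLeviGL F (id : Fin 3 → Fin 3))) [IsHaarMeasure νT]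
    (dx : Measure F) [dx.IsAddHaarMeasure] :
    ∃ c : ℝ≥0∞, c ≠ 0 ∧ c ≠ ⊤ ∧ ∀ φ : Matrix (Fin 3) (Fin 3) F → ℝ≥0∞, Measurable φ →
      ∫⁻ t, φ ((t : GL (Fin 3) F) : Matrix (Fin 3) (Fin 3) F) ∂νT =
        c * ∫⁻ p : (F × F) × F, φ (Matrix.diagonal ![p.1.1, p.1.2, p.2]) *
          (((normAbs F p.1.1 * normAbs F p.1.2 * normAbs F p.2)⁻¹ : ℝ≥0) : ℝ≥0∞) ∂((dx.prod dx).prod dx) := by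
  haveI : T2Space F := (isLocalField F).toT2Space
  haveI : LocallyCompactSpace F := (isLocalField F).toLocallyCompactSpace
  haveI : SecondCountableTopology F := secondCountableTopology_localField F
  haveI : IsTopologicalRing F := inferInstance
  haveI : BorelSpace Fˣ := Units.borelSpace
  haveI : SecondCountableTopology Fˣ := secondCountableTopology_units F
  haveI : SigmaCompactSpace Fˣ := sigmaCompactSpace_units F
  haveI : LocallyCompactSpace Fˣ := LocalFieldHaar.isOpenEmbedding_unitsVal.locallyCompactSpace
  obtain ⟨e, he⟩ := exists_continuousMulEquiv_units_torus (F := F)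
  haveI : SecondCountableTopology ↥(standardLeviGL F (id : Fin 3 → Fin 3)) := e.symm.toHomeomorph.secondCountableTopology
  haveI : LocallyCompactSpace ↥(standardLeviGL F (id : Fin 3 → Fin 3)) := e.symm.toHomeomorph.isClosedEmbedding.locallyCompactSpace
  -- the density `‖x‖⁻¹` and `d^×x` on `Fˣ`
  set ρ : F → ℝ≥0∞ := fun x => (((normAbs F x)⁻¹ : ℝ≥0) : ℝ≥0∞) with hρ
  have hρm : Measurable ρ := LocalFieldHaar.measurable_inv_normAbs.coe_nnreal_ennreal
  set ν₁ : Measure F := dx.withDensity ρ with hν₁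
  set uF : Measure Fˣ := Measure.comap ((↑) : Fˣ → F) ν₁ with huF
  haveI : IsHaarMeasure uF := LocalFieldHaar.isHaarMeasure_unitsMeasure dx
  -- `Units.val` carries `d^×x` to `‖x‖⁻¹ dx` (the origin is null)
  have hval : MeasurePreserving ((↑) : Fˣ → F) uF ν₁ := by
    refine ⟨LocalFieldHaar.measurableEmbedding_unitsVal.measurable, ?_⟩
    rw [huF, LocalFieldHaar.measurableEmbedding_unitsVal.map_comap, LocalFieldHaar.range_unitsVal, Measure.restrict_eq_self_of_ae_mem]
    exact compl_mem_ae_iff.2 (withDensity_absolutelyContinuous dx _ (LocalFieldHaar.measure_singleton_zero dx))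
  -- the product Haar measure on `(Fˣ × Fˣ) × Fˣ`, carried to `T`; Haar uniqueness on `T`
  set P : Measure ((Fˣ × Fˣ) × Fˣ) := (uF.prod uF).prod uF with hP
  haveI : IsHaarMeasure (P.map e) := e.isHaarMeasure_map P
  have hνT : νT = νT.haarScalarFactor (P.map e) • P.map e := isMulLeftInvariant_eq_smul νT _
  refine ⟨νT.haarScalarFactor (P.map e), ENNReal.coe_ne_zero.2 (haarScalarFactor_pos_of_isHaarMeasure _ _).ne', ENNReal.coe_ne_top,
    fun φ hφ => ?_⟩
  have hmeas : Measurable fun p : (F × F) × F => φ (Matrix.diagonal ![p.1.1, p.1.2, p.2]) := hφ.comp continuous_diagonal_prod.measurable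
  have hφT : Measurable fun t : ↥(standardLeviGL F (id : Fin 3 → Fin 3)) => φ ((t : GL (Fin 3) F) : Matrix (Fin 3) (Fin 3) F) :=
    hφ.comp (Units.continuous_val.comp continuous_subtype_val).measurable
  have hcoords : MeasurePreserving (Prod.map (Prod.map ((↑) : Fˣ → F) ((↑) : Fˣ → F)) ((↑) : Fˣ → F)) P ((ν₁.prod ν₁).prod ν₁) :=
    (hval.prod hval).prod hval
  have h1 : ∫⁻ t, φ ((t : GL (Fin 3) F) : Matrix (Fin 3) (Fin 3) F) ∂(P.map e) =
      ∫⁻ w : (Fˣ × Fˣ) × Fˣ, φ (Matrix.diagonal ![((w.1.1 : Fˣ) : F), ((w.1.2 : Fˣ) : F), ((w.2 : Fˣ) : F)]) ∂P := by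
    rw [lintegral_map hφT (show Measurable (e : (Fˣ × Fˣ) × Fˣ → _) from e.continuous.measurable)]
    exact lintegral_congr fun w => by rw [he]
  have h2 : ∫⁻ w : (Fˣ × Fˣ) × Fˣ, φ (Matrix.diagonal ![((w.1.1 : Fˣ) : F), ((w.1.2 : Fˣ) : F), ((w.2 : Fˣ) : F)]) ∂P =
      ∫⁻ p : (F × F) × F, φ (Matrix.diagonal ![p.1.1, p.1.2, p.2]) ∂((ν₁.prod ν₁).prod ν₁) := by
    rw [← hcoords.lintegral_comp hmeas]
    rfl
  have h3 : (ν₁.prod ν₁).prod ν₁ = ((dx.prod dx).prod dx).withDensity fun p => (ρ p.1.1 * ρ p.1.2) * ρ p.2 := by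
    rw [hν₁, prod_withDensity hρm hρm,
      prod_withDensity (show Measurable fun z : F × F => ρ z.1 * ρ z.2 from (hρm.comp measurable_fst).mul (hρm.comp measurable_snd)) hρm]
  conv_lhs => rw [hνT]
  rw [lintegral_smul_measure, h1, h2, h3, lintegral_withDensity_eq_lintegral_mul _
    (show Measurable (fun p : (F × F) × F => (ρ p.1.1 * ρ p.1.2) * ρ p.2) from
      ((hρm.comp measurable_fst.fst).mul (hρm.comp measurable_fst.snd)).mul (hρm.comp measurable_snd)) hmeas]
  simp only [ENNReal.smul_def, smul_eq_mul]
  exact congrArg _ (lintegral_congr fun p => by simp only [Pi.mul_apply, hρ, mul_inv, ENNReal.coe_mul]; ring)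

end TorusHaar

/-! ## §2  Merging the coordinates: `(((d₀,d₁),d₂),((x,y),z)) ↦ (d₀, x, z, d₁, y, d₂) ∈ F⁶` -/

section Merge

variable {F : Type*} [MeasurableSpace F]

/-- The merge map `(((d₀,d₁),d₂),((x,y),z)) ↦ (d₀, x, z, d₁, y, d₂)` is measurable. [folklore] -/
theorem measurable_merge :
    Measurable fun z : ((F × F) × F) × ((F × F) × F) => (![z.1.1.1, z.2.1.1, z.2.2, z.1.1.2, z.2.1.2, z.1.2] : Fin 6 → F) := by
  refine measurable_pi_iff.2 fun i => ?_
  fin_cases i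
  · simpa using measurable_fst.fst.fst
  · simpa using measurable_snd.fst.fst
  · simpa using measurable_snd.snd
  · simpa using measurable_fst.fst.snd
  · simpa using measurable_snd.fst.snd
  · simpa using measurable_fst.snd

/-- **The merge map carries `dx^{⊗3} ⊗ dx^{⊗3}` to `dx^{⊗6}`** (`Measure.pi_eq` on boxes). [folklore] -/
theorem measurePreserving_merge (dx : Measure F) [SigmaFinite dx] :
    MeasurePreserving (fun z : ((F × F) × F) × ((F × F) × F) => (![z.1.1.1, z.2.1.1, z.2.2, z.1.1.2, z.2.1.2, z.1.2] : Fin 6 → F))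
      ((((dx.prod dx).prod dx)).prod ((dx.prod dx).prod dx)) (Measure.pi fun _ : Fin 6 => dx) := by
  refine ⟨measurable_merge, Eq.symm (Measure.pi_eq fun s hs => ?_)⟩
  rw [Measure.map_apply measurable_merge (MeasurableSet.univ_pi hs)]
  have hpre : (fun z : ((F × F) × F) × ((F × F) × F) => (![z.1.1.1, z.2.1.1, z.2.2, z.1.1.2, z.2.1.2, z.1.2] : Fin 6 → F)) ⁻¹'
      (Set.univ.pi s) = ((s 0 ×ˢ s 3) ×ˢ s 5) ×ˢ ((s 1 ×ˢ s 4) ×ˢ s 2) := by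
    ext z
    simp only [Set.mem_preimage, Set.mem_univ_pi, Set.mem_prod]
    refine ⟨fun h => ?_, ?_⟩
    · exact ⟨⟨⟨by simpa using h 0, by simpa using h 3⟩, by simpa using h 5⟩, ⟨⟨by simpa using h 1, by simpa using h 4⟩, by simpa using h 2⟩⟩
    · rintro ⟨⟨⟨h0, h3⟩, h5⟩, ⟨⟨h1, h4⟩, h2⟩⟩ i
      fin_cases i <;> simp [h0, h1, h2, h3, h4, h5]
  rw [hpre, Measure.prod_prod, Measure.prod_prod, Measure.prod_prod, Measure.prod_prod, Measure.prod_prod, Fin.prod_univ_six]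
  ring

end Merge

/-! ## §3  The (nsc-K𝔟-MU) identity: `νT ⊗ μN` on `T × N₃` in the coordinates of the Borel slice `b(r)` -/

section MU

variable {F : Type*} [Field F] [ValuativeRel F] [TopologicalSpace F] [IsNonarchimedeanLocalField F]
  [MeasurableSpace F] [BorelSpace F]
  [MeasurableSpace (Matrix (Fin 3) (Fin 3) F)] [BorelSpace (Matrix (Fin 3) (Fin 3) F)]
  [MeasurableSpace ↥(standardLeviGL F (id : Fin 3 → Fin 3))] [BorelSpace ↥(standardLeviGL F (id : Fin 3 → Fin 3))]
  [MeasurableSpace ↥(unipotentRadicalGL F (id : Fin 3 → Fin 3))] [BorelSpace ↥(unipotentRadicalGL F (id : Fin 3 → Fin 3))]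

/-- **THE (nsc-K𝔟-MU) IDENTITY — THE HAAR MEASURE `νT ⊗ μN` OF `T × N₃` IN THE COORDINATES OF THE BOREL SLICE.**  For Haar measures `νT` on the diagonal
torus `T = standardLeviGL F id`, `μN` on the upper unitriangular group `N₃ = unipotentRadicalGL F id` of `GL₃(F)` and an additive Haar measure `dx` on `F`
there is `c ∈ (0, ∞)` such that for every Borel `g : 𝔤𝔩₃(F) → [0, ∞]`
`∫_T ∫_{N₃} g(t u) dμN dνT = c · ∫_{F⁶} 1[r₀ ≠ 0 ∧ r₃ ≠ 0 ∧ r₅ ≠ 0] · g(b(r)) · (‖r₀‖³ ‖r₃‖² ‖r₅‖)⁻¹ dr`, `b(r) = [[r₀,r₁,r₂],[0,r₃,r₄],[0,0,r₅]]`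
— the left Haar measure of the Borel subgroup `B = T N₃` read in the additive coordinates of `𝔟 ≅ F⁶` with its modulus density (`t u = diag(d)·n(x,y,z) =
b(d₀, d₀x, d₀z, d₁, d₁y, d₂)`; §1 for `T`, ★ `K2E3GL3BorelUnipotentHaar.exists_haar_eq_smul_map_coord` for `N₃`, the substitution `x' = d₀x, z' = d₀z,
y' = d₁y` ★ `map_coordScale`, Tonelli, §2).  [cite: Cartier1979, §IV.1 p. 145] [cite: WeilBNT1967, Ch. II §1] [cite: BernsteinZelevinsky1976, §1.19] -/
theorem exists_lintegral_torus_unipotent_eq_mul_lintegral_pi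
    (νT : Measure ↥(standardLeviGL F (id : Fin 3 → Fin 3))) [IsHaarMeasure νT]
    (μN : Measure ↥(unipotentRadicalGL F (id : Fin 3 → Fin 3))) [IsHaarMeasure μN]
    (dx : Measure F) [dx.IsAddHaarMeasure] :
    ∃ c : ℝ≥0∞, c ≠ 0 ∧ c ≠ ⊤ ∧ ∀ g : Matrix (Fin 3) (Fin 3) F → ℝ≥0∞, Measurable g →
      ∫⁻ t, ∫⁻ u, g ((((t : GL (Fin 3) F) * (u : GL (Fin 3) F) : GL (Fin 3) F)) : Matrix (Fin 3) (Fin 3) F) ∂μN ∂νT =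
        c * ∫⁻ r : Fin 6 → F, {r : Fin 6 → F | r 0 ≠ 0 ∧ r 3 ≠ 0 ∧ r 5 ≠ 0}.indicator
          (fun r => g !![r 0, r 1, r 2; 0, r 3, r 4; 0, 0, r 5] *
            (((normAbs F (r 0) ^ 3 * normAbs F (r 3) ^ 2 * normAbs F (r 5))⁻¹ : ℝ≥0) : ℝ≥0∞)) r ∂(Measure.pi fun _ : Fin 6 => dx) := by
  haveI : T2Space F := (isLocalField F).toT2Space
  haveI : LocallyCompactSpace F := (isLocalField F).toLocallyCompactSpace
  haveI : SecondCountableTopology F := secondCountableTopology_localField F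
  haveI : IsTopologicalRing F := inferInstance
  -- the inputs: `N₃` in coordinates (★), the torus in coordinates (§1)
  obtain ⟨eN, heN⟩ := K2E3GL3BorelUnipotentHaar.exists_coordHomeomorph (R := F)
  obtain ⟨C, hC0, hμN⟩ := K2E3GL3BorelUnipotentHaar.exists_haar_eq_smul_map_coord eN heN dx μN
  obtain ⟨c₁, hc₁0, hc₁t, hT⟩ := exists_lintegral_torus_eq_mul_lintegral_prod νT dx
  refine ⟨c₁ * C, mul_ne_zero hc₁0 (ENNReal.coe_ne_zero.2 hC0), ENNReal.mul_ne_top hc₁t ENNReal.coe_ne_top, fun g hg => ?_⟩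
  have hN : Measurable (normAbs F : F → ℝ≥0) := LocalFieldHaar.measurable_normAbs
  set μ3 : Measure ((F × F) × F) := (dx.prod dx).prod dx with hμ3
  -- the slice matrices `n(q)` and `B(p, q)`
  set n : (F × F) × F → Matrix (Fin 3) (Fin 3) F := fun q => !![(1 : F), q.1.1, q.2; 0, 1, q.1.2; 0, 0, 1] with hn
  set B : (F × F) × F → (F × F) × F → Matrix (Fin 3) (Fin 3) F := fun p q => !![p.1.1, q.1.1, q.2; 0, p.1.2, q.1.2; 0, 0, p.2] with hB
  let W : (F × F) × F → ℝ≥0∞ := fun p => (((normAbs F p.1.1 ^ 3 * normAbs F p.1.2 ^ 2 * normAbs F p.2)⁻¹ : ℝ≥0) : ℝ≥0∞)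
  have hWp : ∀ p, W p = (((normAbs F p.1.1 ^ 3 * normAbs F p.1.2 ^ 2 * normAbs F p.2)⁻¹ : ℝ≥0) : ℝ≥0∞) := fun p => rfl
  have hnc : Continuous n := by
    refine continuous_matrix (fun i j => ?_); fin_cases i <;> fin_cases j <;> simp [hn] <;> fun_prop
  have hBc : Continuous fun z : ((F × F) × F) × ((F × F) × F) => B z.1 z.2 := by
    refine continuous_matrix (fun i j => ?_); fin_cases i <;> fin_cases j <;> simp [hB] <;> fun_prop
  have hBm : ∀ p, Measurable fun q => g (B p q) := fun p => hg.comp (hBc.comp (continuous_const.prodMk continuous_id)).measurable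
  have hWm : Measurable W :=
    ((((hN.comp measurable_fst.fst).pow_const 3).mul ((hN.comp measurable_fst.snd).pow_const 2)).mul (hN.comp measurable_snd)).inv.coe_nnreal_ennreal
  -- Step 1: the inner integral in coordinates, for every matrix `X`
  have h1 : ∀ X : Matrix (Fin 3) (Fin 3) F,
      ∫⁻ u, g (X * (((u : ↥(unipotentRadicalGL F (id : Fin 3 → Fin 3))) : GL (Fin 3) F) : Matrix (Fin 3) (Fin 3) F)) ∂μN =
        C * ∫⁻ q, g (X * n q) ∂μ3 := by
    intro X
    have hm : Measurable fun u : ↥(unipotentRadicalGL F (id : Fin 3 → Fin 3)) => g (X * ((u : GL (Fin 3) F) : Matrix (Fin 3) (Fin 3) F)) :=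
      hg.comp (continuous_const.mul (Units.continuous_val.comp continuous_subtype_val)).measurable
    rw [hμN, lintegral_smul_measure, lintegral_map hm eN.continuous.measurable]
    simp only [ENNReal.smul_def, smul_eq_mul]
    exact congrArg _ (lintegral_congr fun q => by rw [heN])
  -- Step 2: the torus in coordinates, applied to `X ↦ C ∫ g(X n(q)) dq`
  have hjoint : Measurable fun z : Matrix (Fin 3) (Fin 3) F × ((F × F) × F) => g (z.1 * n z.2) :=
    hg.comp ((continuous_fst.mul (hnc.comp continuous_snd)).measurable)
  have hΦm : Measurable fun X : Matrix (Fin 3) (Fin 3) F => C * ∫⁻ q, g (X * n q) ∂μ3 := (hjoint.lintegral_prod_right').const_mul _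
  have h2 : ∫⁻ t, ∫⁻ u, g ((((t : GL (Fin 3) F) * (u : GL (Fin 3) F) : GL (Fin 3) F)) : Matrix (Fin 3) (Fin 3) F) ∂μN ∂νT =
      c₁ * ∫⁻ p : (F × F) × F, (C * ∫⁻ q, g (Matrix.diagonal ![p.1.1, p.1.2, p.2] * n q) ∂μ3) *
        (((normAbs F p.1.1 * normAbs F p.1.2 * normAbs F p.2)⁻¹ : ℝ≥0) : ℝ≥0∞) ∂μ3 := by
    rw [← hT _ hΦm]
    refine lintegral_congr fun t => ?_
    simp only [Units.val_mul]
    exact h1 _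
  -- Step 3: the substitution `x' = d₀x, z' = d₀z, y' = d₁y` for every `p`
  have h3 : ∀ p : (F × F) × F,
      (C * ∫⁻ q, g (Matrix.diagonal ![p.1.1, p.1.2, p.2] * n q) ∂μ3) * (((normAbs F p.1.1 * normAbs F p.1.2 * normAbs F p.2)⁻¹ : ℝ≥0) : ℝ≥0∞) =
        C * ((∫⁻ q, g (B p q) ∂μ3) * W p) := by
    intro p
    by_cases hp : p.1.1 ≠ 0 ∧ p.1.2 ≠ 0 ∧ p.2 ≠ 0
    · obtain ⟨h0, h1', -⟩ := hp
      have hD : Measurable fun q : (F × F) × F => ((p.1.1 * q.1.1, p.1.2 * q.1.2), p.1.1 * q.2) := by fun_prop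
      have heq : ∀ q, Matrix.diagonal ![p.1.1, p.1.2, p.2] * n q = B p ((p.1.1 * q.1.1, p.1.2 * q.1.2), p.1.1 * q.2) := fun q => by
        simp only [hn, hB, diagonal_mul_unipotent]
      have hsub : ∫⁻ q, g (Matrix.diagonal ![p.1.1, p.1.2, p.2] * n q) ∂μ3 =
          (((normAbs F p.1.1⁻¹ * normAbs F p.1.2⁻¹ * normAbs F p.1.1⁻¹ : ℝ≥0)) : ℝ≥0∞) * ∫⁻ q, g (B p q) ∂μ3 := by
        simp_rw [heq]
        rw [← lintegral_map (hBm p) hD, hμ3, K2E3GL3BorelUnipotentHaar.map_coordScale dx h0 h1' h0, lintegral_smul_measure]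
        simp only [smul_eq_mul]
      have hab : (normAbs F p.1.1⁻¹ * normAbs F p.1.2⁻¹ * normAbs F p.1.1⁻¹) * (normAbs F p.1.1 * normAbs F p.1.2 * normAbs F p.2)⁻¹ =
          (normAbs F p.1.1 ^ 3 * normAbs F p.1.2 ^ 2 * normAbs F p.2)⁻¹ := by
        rw [map_inv₀, map_inv₀, ← mul_inv, ← mul_inv, ← mul_inv]; congr 1; ring
      rw [hsub, hWp, ← hab]
      calc _ = (C : ℝ≥0∞) * ((∫⁻ q, g (B p q) ∂μ3) * ((((normAbs F p.1.1⁻¹ * normAbs F p.1.2⁻¹ * normAbs F p.1.1⁻¹ : ℝ≥0)) : ℝ≥0∞) *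
          (((normAbs F p.1.1 * normAbs F p.1.2 * normAbs F p.2)⁻¹ : ℝ≥0) : ℝ≥0∞))) := by ring
        _ = _ := by rw [← ENNReal.coe_mul]
    · -- a vanishing coordinate: both densities are `0`
      simp only [not_and_or, not_not] at hp
      have hz : normAbs F p.1.1 * normAbs F p.1.2 * normAbs F p.2 = 0 := by rcases hp with h | h | h <;> simp [h]
      have hz' : W p = 0 := by
        have h' : normAbs F p.1.1 ^ 3 * normAbs F p.1.2 ^ 2 * normAbs F p.2 = 0 := by rcases hp with h | h | h <;> simp [h]
        rw [hWp, h', inv_zero, ENNReal.coe_zero]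
      rw [hz, hz', inv_zero, ENNReal.coe_zero, mul_zero, mul_zero, mul_zero]
  simp_rw [h3] at h2
  -- Step 4: Tonelli on `μ3 ⊗ μ3`
  have hIm : Measurable fun p : (F × F) × F => ∫⁻ q, g (B p q) ∂μ3 := (hg.comp hBc.measurable).lintegral_prod_right'
  have hGm : Measurable fun z : ((F × F) × F) × ((F × F) × F) => g (B z.1 z.2) * W z.1 := (hg.comp hBc.measurable).mul (hWm.comp measurable_fst)
  have h4 : ∫⁻ p : (F × F) × F, C * ((∫⁻ q, g (B p q) ∂μ3) * W p) ∂μ3 =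
      C * ∫⁻ z : ((F × F) × F) × ((F × F) × F), g (B z.1 z.2) * W z.1 ∂(μ3.prod μ3) := by
    rw [lintegral_const_mul _ (show Measurable (fun p : (F × F) × F => (∫⁻ q, g (B p q) ∂μ3) * W p) from hIm.mul hWm),
      lintegral_prod _ hGm.aemeasurable]
    exact congrArg _ (lintegral_congr fun p => by dsimp only; rw [lintegral_mul_const _ (hBm p)])
  -- Step 5: the merge `(p, q) ↦ r ∈ F⁶`
  set H : (Fin 6 → F) → ℝ≥0∞ := fun r => {r : Fin 6 → F | r 0 ≠ 0 ∧ r 3 ≠ 0 ∧ r 5 ≠ 0}.indicator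
      (fun r => g !![r 0, r 1, r 2; 0, r 3, r 4; 0, 0, r 5] *
        (((normAbs F (r 0) ^ 3 * normAbs F (r 3) ^ 2 * normAbs F (r 5))⁻¹ : ℝ≥0) : ℝ≥0∞)) r with hH
  have hSm : MeasurableSet {r : Fin 6 → F | r 0 ≠ 0 ∧ r 3 ≠ 0 ∧ r 5 ≠ 0} := by
    have h : ∀ i : Fin 6, MeasurableSet {r : Fin 6 → F | r i ≠ 0} := fun i =>
      (measurableSet_singleton (0 : F)).compl.preimage (measurable_pi_apply i)
    exact (h 0).inter ((h 3).inter (h 5))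
  have hHm : Measurable H := by
    refine Measurable.indicator ((hg.comp measurable_borelSlice).mul ?_) hSm
    exact ((((hN.comp (measurable_pi_apply (0 : Fin 6))).pow_const 3).mul ((hN.comp (measurable_pi_apply (3 : Fin 6))).pow_const 2)).mul
      (hN.comp (measurable_pi_apply (5 : Fin 6)))).inv.coe_nnreal_ennreal
  have hHz : ∀ z : ((F × F) × F) × ((F × F) × F), H (![z.1.1.1, z.2.1.1, z.2.2, z.1.1.2, z.2.1.2, z.1.2]) = g (B z.1 z.2) * W z.1 := by
    intro z
    simp only [hH]
    by_cases h : z.1.1.1 ≠ 0 ∧ z.1.1.2 ≠ 0 ∧ z.1.2 ≠ 0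
    · rw [Set.indicator_of_mem (by simpa using h)]
      simp [hB, hWp]
    · rw [Set.indicator_of_notMem (by simpa using h)]
      simp only [not_and_or, not_not] at h
      have hz : normAbs F z.1.1.1 ^ 3 * normAbs F z.1.1.2 ^ 2 * normAbs F z.1.2 = 0 := by rcases h with h | h | h <;> simp [h]
      rw [hWp, hz, inv_zero, ENNReal.coe_zero, mul_zero]
  have h5 : ∫⁻ z : ((F × F) × F) × ((F × F) × F), g (B z.1 z.2) * W z.1 ∂(μ3.prod μ3) = ∫⁻ r, H r ∂(Measure.pi fun _ : Fin 6 => dx) := by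
    rw [← (measurePreserving_merge dx).lintegral_comp hHm]
    exact lintegral_congr fun z => (hHz z).symm
  rw [h2, h4, h5, mul_assoc]

end MU

end Summit.HodgeConjecture.HodgeConjecture.Cruxes.H413.K2E3GL3BorelLeviUnipotentCoordinates

end
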